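import Summits.Ventures.HSemireg.WedgeHankelOuterPure
import Summits.Ventures.HSemireg.WedgeHankelPairGradingMaps

/-!
# Venture HSemireg — EVERY PAIR-TYPE PIECE OF TH-7's KERNEL AND IMAGE IN CLOSED FORM: a piece of pair type `τ` with a FULL PAIR (`τ c = 2`) lies entirely in the kernel and
# contributes nothing to the image; the image of the PURE piece on a `k`-set `A` of pairs is the piece of type `𝟙_A + 𝟙` of the image and has dimension EXACTLY
# `rank H_k(q)` — **th-7's count `dim V = C(n,k) · rank H_k(q)` is `rank H_k(q)` from EACH of the `C(n,k)` sets `A`**, every field, uniform in `n`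

HONEST FRAMING. Part of the Lean index of the computation cell `pub-hsemireg` (seat p10 gen 23, Sunday typer «UNIFORM-IN-n»).
Finite-dimensional EXTERIOR ALGEBRA over a field ONLY: no variety, no cohomology theory, no sheaf, no Ext group, no semiregularity map;
nothing here says that HC / HC_CM / HC_AV holds; no Literature fact is declared or used.  Custodian versions as in `WedgeHankelSiegelIdeal` (1/3); the dictionary (`w_N(q)` = the
class of the box on `N` pairs; pair type = multidegree in the factors; `H_k(q)` = the `k`-th Hankel matrix) is QUOTED, never asserted.

WHAT IS IN THE TREE.  H10 `WedgeHankelPairGrading` / I5 `WedgeHankelPairGradingMaps` (this lineage): `ptype`, `proj_ptype_mem_Kr_w`, `proj_ptype_succ_mul` (`proj_{τ+1}(θ ∧ f) =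
proj_τ θ ∧ f`), `proj_ptype_mul_eq_zero_of_exists_zero`, `mul_mem_Sp_ptype_succ`, `V_eq_sup_inf_Sp_ptype`; L2 (this seat, `WedgeHankelOuterPure`): `ptype_le_one_of_not_pair_subset`,
`B_mul_eq_zero_of_pair_subset`, `Sp_pure_le`, `finrank_Sp_pure` (`2^{|A|}`), `finrank_Kr_w_inf_Sp_pure_add` (`dim (Kr ⊓ Sp(ptype = 𝟙_A)) + r_{|A|}(q) = 2^{|A|}`).
THIS FILE (namespace `Summit.Ventures.HSemireg.Wedge.HankelOuter` continued; imports L2 and I5):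
* §377 FULL-PAIR PIECES DIE: `pair_subset_of_two_le_ptype`, **`Sp_ptype_le_ker_of_two_le`** (`τ c ≥ 2` ⇒ `Sp(ptype = τ) ∧ f = 0` for every transversal `f`),
  **`Kr_inf_Sp_ptype_eq_Hom_inf_of_two_le`** (`Kr(univ, f, k) ⊓ Sp(ptype = τ) = Hom(univ, k) ⊓ Sp(ptype = τ)`: the whole piece is kernel).
* §378 THE IMAGE OF A PIECE: **`V_inf_Sp_ptype_succ_eq_map`** (`V(univ, f, k) ⊓ Sp(ptype = τ + 1)` is the image of the piece `Hom(univ,k) ⊓ Sp(ptype = τ)` under `∧ f`),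
  **`finrank_V_inf_Sp_ptype_succ_add`** (rank–nullity piece by piece: `dim (V ⊓ Sp(τ+1)) + dim (Kr ⊓ Sp(τ)) = dim (Hom(univ,k) ⊓ Sp(τ))`), `V_inf_Sp_ptype_eq_bot_of_exists_zero`
  (types with an empty pair carry no image), `finrank_V_inf_Sp_ptype_succ_eq_zero_of_two_le` (types with a full pair carry no image).
* §379 THE VALUE FOR TH-7's CLASS: `Hom_inf_Sp_pure` (`Hom(univ, |A|) ⊓ Sp(ptype = 𝟙_A) = Sp(ptype = 𝟙_A)`), **`finrank_V_w_inf_Sp_pure_succ`: `dim (V(univ, w_N q, |A|) ⊓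
  Sp(ptype = 𝟙_A + 𝟙)) = rank (hankel1 K N |A| q)` for EVERY set `A` of pairs** (and the spelling `finrank_V_w_inf_Sp_two_one` with the type written `c ↦ if c ∈ A then 2 else 1`).
READING: the image of th-7's map `θ ↦ θ ∧ w_N(q)` on `k`-forms decomposes over the `k`-subsets `A` of the pairs (the other pair types contribute `0`), and EVERY `A` contributes
a piece of dimension exactly `r_k(q)`: th-7's `C(n,k) · r_k(q)` term by term.  Dually every pure kernel piece has dimension `2^k − r_k(q)` (L2) and every non-pure piece is
all kernel.  Nothing Ext-side.  New names only.
-/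

open Module

namespace Summit.Ventures.HSemireg.Wedge.HankelOuter

open Summit.Ventures.HSemireg.Wedge Summit.Ventures.HSemireg.Wedge.Kunneth Summit.Ventures.HSemireg.Wedge.Hankel
  Summit.Ventures.HSemireg.Wedge.BasisFree Summit.Ventures.HSemireg.Wedge.HankelSiegel Summit.Ventures.HSemireg.Wedge.HankelSiegelIdeal
  Summit.Ventures.HSemireg.Wedge.KunnethKernel Summit.Ventures.HSemireg.Wedge.HankelFrameChange Summit.Ventures.HSemireg.Wedge.Weil
  Summit.Ventures.HSemireg.Wedge.HankelPairMixing Summit.Ventures.HSemireg.Wedge.HankelPairGrading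

variable (K : Type*) [Field K] {N : ℕ}

/-! ## §377. Full-pair pieces die -/

omit [Field K] in
/-- `ptype s c ≥ 2` means both letters of the pair `c` lie in `s`. -/
theorem pair_subset_of_two_le_ptype {s : Finset (In N)} {c : Fin N} (h : 2 ≤ ptype s c) : xJ N c ∈ s ∧ yJ N c ∈ s := by
  by_contra hno
  have := ptype_le_one_of_not_pair_subset hno
  omega

omit [Field K] in
/-- conversely both letters of the pair `c` in `s` give `ptype s c = 2` (the pair has only two letters). -/
theorem ptype_eq_two_of_pair_subset {s : Finset (In N)} {c : Fin N} (hx : xJ N c ∈ s) (hy : yJ N c ∈ s) : ptype s c = 2 := by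
  apply le_antisymm
  · rw [ptype]
    refine le_trans (Finset.card_le_card fun j hj => ?_) (le_of_eq (Finset.card_pair (xJ_ne_yJ c c)))
    rw [Finset.mem_filter] at hj
    rw [Finset.mem_insert, Finset.mem_singleton]
    rcases eq_xJ_or_eq_yJ j with e | e <;> rw [hj.2] at e
    · exact Or.inl e
    · exact Or.inr e
  · rw [ptype, ← Finset.card_pair (xJ_ne_yJ c c)]
    refine Finset.card_le_card fun j hj => ?_
    rw [Finset.mem_insert, Finset.mem_singleton] at hj
    rw [Finset.mem_filter]
    rcases hj with rfl | rfl
    · exact ⟨hx, pr_xJ c⟩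
    · exact ⟨hy, pr_yJ c⟩

/-- **A PAIR TYPE WITH A FULL PAIR KILLS EVERY TRANSVERSAL CLASS: `Sp(ptype = τ) ≤ ker (· ∧ f)` when `τ c ≥ 2`** (each of its monomials contains `x_c ∧ y_c`). -/
theorem Sp_ptype_le_ker_of_two_le {τ : Fin N → ℕ} {c : Fin N} (h : 2 ≤ τ c) {f : HT K (In N)} (hf : f ∈ Sp K (Tr (N := N))) :
    Sp K (fun s : Finset (In N) => ptype s = τ) ≤ LinearMap.ker (LinearMap.mulRight K f) := by
  rw [Sp, Submodule.span_le]
  rintro _ ⟨s, hs, rfl⟩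
  have h2 : 2 ≤ ptype s c := by rw [show ptype s = τ from hs]; exact h
  obtain ⟨hx, hy⟩ := pair_subset_of_two_le_ptype h2
  rw [SetLike.mem_coe, LinearMap.mem_ker, LinearMap.mulRight_apply]
  exact B_mul_eq_zero_of_pair_subset K hx hy hf

/-- **THE WHOLE PIECE IS KERNEL: `Kr(univ, f, k) ⊓ Sp(ptype = τ) = Hom(univ, k) ⊓ Sp(ptype = τ)` when `τ c ≥ 2`** (`f` transversal; every degree `k`). -/
theorem Kr_inf_Sp_ptype_eq_Hom_inf_of_two_le {τ : Fin N → ℕ} {c : Fin N} (h : 2 ≤ τ c) {f : HT K (In N)} (hf : f ∈ Sp K (Tr (N := N))) (k : ℕ) :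
    Kr K (Finset.univ : Finset (In N)) f k ⊓ Sp K (fun s : Finset (In N) => ptype s = τ)
      = Hom K (In N) (Finset.univ : Finset (In N)) k ⊓ Sp K (fun s : Finset (In N) => ptype s = τ) := by
  rw [Kr, inf_right_comm]
  exact inf_eq_left.mpr (le_trans inf_le_right (Sp_ptype_le_ker_of_two_le K h hf))

/-- … in particular for th-7's class `w_N(q)`, with the dimension read off the count of supports. -/
theorem finrank_Kr_w_inf_Sp_ptype_of_two_le {τ : Fin N → ℕ} {c : Fin N} (h : 2 ≤ τ c) (q : ℕ → K) (k : ℕ) [DecidablePred fun s : Finset (In N) => s.card = k ∧ ptype s = τ] :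
    finrank K ↥(Kr K (Finset.univ : Finset (In N)) (w K N N q) k ⊓ Sp K (fun s : Finset (In N) => ptype s = τ))
      = (Finset.univ.filter fun s : Finset (In N) => s.card = k ∧ ptype s = τ).card := by
  have hSp : Sp K (fun s : Finset (In N) => (s ⊆ Finset.univ ∧ s.card = k) ∧ ptype s = τ) = Sp K (fun s : Finset (In N) => s.card = k ∧ ptype s = τ) :=
    Sp_congr_iff K fun s => ⟨fun hs => ⟨hs.1.2, hs.2⟩, fun hs => ⟨⟨Finset.subset_univ _, hs.1⟩, hs.2⟩⟩
  rw [Kr_inf_Sp_ptype_eq_Hom_inf_of_two_le K h (w_mem_Sp_Tr K q), Hom_eq_Sp, Sp_inf_Sp, hSp, finrank_Sp]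

/-! ## §378. The image of a pair-type piece -/

/-- **`V(univ, f, k) ⊓ Sp(ptype = τ + 1)` IS THE IMAGE OF THE PIECE `Hom(univ, k) ⊓ Sp(ptype = τ)` under `θ ↦ θ ∧ f`** (`f` transversal): products of the `τ`-piece have
type `τ + 1`, and the `τ + 1`-component of any `θ ∧ f` is `proj_τ θ ∧ f`. -/
theorem V_inf_Sp_ptype_succ_eq_map (τ : Fin N → ℕ) {f : HT K (In N)} (hf : f ∈ Sp K (Tr (N := N))) (k : ℕ) :
    V K (In N) (Finset.univ : Finset (In N)) f k ⊓ Sp K (fun s : Finset (In N) => ptype s = τ + 1)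
      = (Hom K (In N) (Finset.univ : Finset (In N)) k ⊓ Sp K (fun s : Finset (In N) => ptype s = τ)).map (LinearMap.mulRight K f) := by
  classical
  refine le_antisymm ?_ ?_
  · rintro v ⟨hv, hvσ⟩
    rw [V_eq_map] at hv
    obtain ⟨θ, hθ, rfl⟩ := hv
    refine ⟨proj (K := K) (fun s : Finset (In N) => ptype s = τ) θ, ⟨proj_mem_Hom K _ hθ, proj_mem _ θ⟩, ?_⟩
    rw [LinearMap.mulRight_apply, LinearMap.mulRight_apply, ← proj_ptype_succ_mul K τ θ hf]
    exact proj_eq_self (fun s h => h) hvσ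
  · rintro _ ⟨θ, ⟨hθ, hθτ⟩, rfl⟩
    refine ⟨?_, ?_⟩
    · rw [V_eq_map]
      exact Submodule.mem_map_of_mem hθ
    · rw [LinearMap.mulRight_apply]
      exact mul_mem_Sp_ptype_succ K hθτ hf

/-- **RANK–NULLITY PIECE BY PIECE: `dim (V(univ,f,k) ⊓ Sp(ptype = τ+1)) + dim (Kr(univ,f,k) ⊓ Sp(ptype = τ)) = dim (Hom(univ,k) ⊓ Sp(ptype = τ))`** (`f` transversal). -/
theorem finrank_V_inf_Sp_ptype_succ_add (τ : Fin N → ℕ) {f : HT K (In N)} (hf : f ∈ Sp K (Tr (N := N))) (k : ℕ) :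
    finrank K ↥(V K (In N) (Finset.univ : Finset (In N)) f k ⊓ Sp K (fun s : Finset (In N) => ptype s = τ + 1))
      + finrank K ↥(Kr K (Finset.univ : Finset (In N)) f k ⊓ Sp K (fun s : Finset (In N) => ptype s = τ))
      = finrank K ↥(Hom K (In N) (Finset.univ : Finset (In N)) k ⊓ Sp K (fun s : Finset (In N) => ptype s = τ)) := by
  let P : Submodule K (HT K (In N)) := Hom K (In N) (Finset.univ : Finset (In N)) k ⊓ Sp K (fun s : Finset (In N) => ptype s = τ)
  let g : P →ₗ[K] HT K (In N) := (LinearMap.mulRight K f) ∘ₗ P.subtype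
  have hrange : LinearMap.range g = V K (In N) (Finset.univ : Finset (In N)) f k ⊓ Sp K (fun s : Finset (In N) => ptype s = τ + 1) := by
    rw [LinearMap.range_comp, Submodule.range_subtype, V_inf_Sp_ptype_succ_eq_map K τ hf k]
  have hker : LinearMap.ker g = (Kr K (Finset.univ : Finset (In N)) f k ⊓ Sp K (fun s : Finset (In N) => ptype s = τ)).comap P.subtype := by
    ext θ
    rw [LinearMap.mem_ker, Submodule.mem_comap, Submodule.subtype_apply, Submodule.mem_inf, mem_Kr, LinearMap.comp_apply, Submodule.subtype_apply,
      LinearMap.mulRight_apply]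
    exact ⟨fun h => ⟨⟨θ.2.1, h⟩, θ.2.2⟩, fun h => h.1.2⟩
  have hle : Kr K (Finset.univ : Finset (In N)) f k ⊓ Sp K (fun s : Finset (In N) => ptype s = τ) ≤ P := inf_le_inf (Kr_le_Hom K _ f k) le_rfl
  have h := LinearMap.finrank_range_add_finrank_ker g
  rw [hrange, hker, (Submodule.comapSubtypeEquivOfLe hle).finrank_eq] at h
  exact h

/-- pair types with an EMPTY pair carry no image: `V(univ, f, k) ⊓ Sp(ptype = σ) = ⊥` if some `σ c = 0` (`f` transversal). -/
theorem V_inf_Sp_ptype_eq_bot_of_exists_zero {σ : Fin N → ℕ} (hσ : ∃ c, σ c = 0) {f : HT K (In N)} (hf : f ∈ Sp K (Tr (N := N))) (k : ℕ) :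
    V K (In N) (Finset.univ : Finset (In N)) f k ⊓ Sp K (fun s : Finset (In N) => ptype s = σ) = ⊥ := by
  classical
  rw [Submodule.eq_bot_iff]
  rintro v ⟨hv, hvσ⟩
  rw [V_eq_map] at hv
  obtain ⟨θ, -, rfl⟩ := hv
  rw [LinearMap.mulRight_apply] at hvσ ⊢
  rw [← proj_eq_self (P := fun s : Finset (In N) => ptype s = σ) (fun s h => h) hvσ]
  exact proj_ptype_mul_eq_zero_of_exists_zero K hσ θ hf

/-- pair types with a FULL pair carry no image either: `dim (V(univ, f, k) ⊓ Sp(ptype = τ + 1)) = 0` if some `τ c ≥ 2` (`f` transversal). -/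
theorem finrank_V_inf_Sp_ptype_succ_eq_zero_of_two_le {τ : Fin N → ℕ} {c : Fin N} (h : 2 ≤ τ c) {f : HT K (In N)} (hf : f ∈ Sp K (Tr (N := N))) (k : ℕ) :
    finrank K ↥(V K (In N) (Finset.univ : Finset (In N)) f k ⊓ Sp K (fun s : Finset (In N) => ptype s = τ + 1)) = 0 := by
  have h1 := finrank_V_inf_Sp_ptype_succ_add K τ hf k
  rw [Kr_inf_Sp_ptype_eq_Hom_inf_of_two_le K h hf k] at h1
  omega

/-! ## §379. The value for th-7's class: every `k`-set of pairs contributes exactly `rank H_k(q)` -/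

/-- `Hom(univ, |A|) ⊓ Sp(ptype = 𝟙_A) = Sp(ptype = 𝟙_A)` (pure supports on `A` have `|A|` letters). -/
theorem Hom_inf_Sp_pure (A : Finset (Fin N)) :
    Hom K (In N) (Finset.univ : Finset (In N)) A.card ⊓ Sp K (fun s : Finset (In N) => ptype s = fun c => if c ∈ A then 1 else 0)
      = Sp K (fun s : Finset (In N) => ptype s = fun c => if c ∈ A then 1 else 0) :=
  inf_eq_right.mpr (le_trans (Sp_pure_le K A) inf_le_left)

/-- **EVERY `k`-SET `A` OF PAIRS CONTRIBUTES EXACTLY `rank H_k(q)` TO THE IMAGE: `dim (V(univ, w_N q, |A|) ⊓ Sp(ptype = 𝟙_A + 𝟙)) = rank (hankel1 K N |A| q)`** (every field,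
every `q`, uniform in `n`): the pure piece on `A` has dimension `2^{|A|}`, its kernel `2^{|A|} − r_{|A|}(q)` (L2), and its image is the `𝟙_A + 𝟙`-piece of the image. -/
theorem finrank_V_w_inf_Sp_pure_succ (A : Finset (Fin N)) (q : ℕ → K) :
    finrank K ↥(V K (In N) (Finset.univ : Finset (In N)) (w K N N q) A.card
        ⊓ Sp K (fun s : Finset (In N) => ptype s = (fun c => if c ∈ A then 1 else 0) + 1)) = (hankel1 K N A.card q).rank := by
  have h1 := finrank_V_inf_Sp_ptype_succ_add K (fun c => if c ∈ A then 1 else 0) (w_mem_Sp_Tr K q) A.card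
  rw [Hom_inf_Sp_pure, finrank_Sp_pure] at h1
  have h2 := finrank_Kr_w_inf_Sp_pure_add K A q
  omega

/-- the same with the type spelled `c ↦ if c ∈ A then 2 else 1`: **`dim (V(univ, w_N q, |A|) ⊓ Sp(ptype = [c ∈ A] + 1)) = rank (hankel1 K N |A| q)`.** -/
theorem finrank_V_w_inf_Sp_two_one (A : Finset (Fin N)) (q : ℕ → K) :
    finrank K ↥(V K (In N) (Finset.univ : Finset (In N)) (w K N N q) A.card ⊓ Sp K (fun s : Finset (In N) => ptype s = fun c => if c ∈ A then 2 else 1))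
      = (hankel1 K N A.card q).rank := by
  have e : (fun c : Fin N => if c ∈ A then (2 : ℕ) else 1) = (fun c : Fin N => if c ∈ A then 1 else 0) + 1 := by
    funext c
    simp only [Pi.add_apply, Pi.one_apply]
    split_ifs <;> rfl
  rw [← finrank_V_w_inf_Sp_pure_succ K A q, e]

end Summit.Ventures.HSemireg.Wedge.HankelOuter
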